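import Summits.ResolutionOfSingularities.ResolutionOfSingularities.Theorems.PurelyInseparableDim4ChartAtlasSNCFarRepairReadingHeightsQuadric
import Summits.ResolutionOfSingularities.ResolutionOfSingularities.Theorems.PurelyInseparableDim4ChartAtlasSNCFarRepairReadingW
import Summits.ResolutionOfSingularities.ResolutionOfSingularities.Theorems.PurelyInseparableDim4ChartAtlasSNCFarRepairCentrePairs
import HarnessLib

/-!
# Purely inseparable four-folds `z^p + F(x₁, …, x₄)`: THE POST-REPAIR READING ON `W`, WITH THE INACTIVE FAR QUADRICS — p724936's package plus the
# second letter (pair-list boundary; cell `res-dim4-pi`, typ-2 g8; HANDOFF g8 OPEN 1)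

[OURS · counted 0] (D-0157 DOOR 2; DR-157-C.) Setting of p724936 `farRepair_reading_W_pairs` (π, chart `j ∈ S`, `b_j = 0`, `Θⱼ` of record, `F₁`
`S'`-permissible, `j ∉ S'`, pair list `L`, `M′`, `Zc`, heights `hs ≠ []` nodup NON-ZERO, `C_W`, τ ANY blowing up of `W` along `C_W`). PROVED here (no
`sorry`, no new axiom): **`farRepair_reading_W_pairs_tquadric`** — the same open immersion package (chart over `x_j`; `St_τ(Zc)` reads `𝓘Λ_{S'}`, single
chart over `φⱼ(𝔸⁵)`; state = the fold of `CentreBlowup.step`; `S'` permissible; exceptional `Π (y_j + (h_last − h))`; hyperplane members) AND clause (9):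
a `W`-ideal `D` whose `φⱼ`-reading is a natural-frame far quadric `((y_k + β)·y_j − 0·y_k + d)·𝒪` of NON-centre index `k ∉ S'`, `k ≠ j` (p720422 §1: the
far pairs `(k, d) ∈ L` with `k ∈ S ∖ S'`) has `St_τ(D)` reading the translated far quadric `((y_k + β)·y_j − (0 − h_last)·y_k + (d + β·h_last))·𝒪` — it
stays in the two-letter alphabet (chart model: `farRepair_chart_reading_heights_tquadric`, hypothesis `0 ∉ hs` = the heights are non-zero).

Together with p725150 (members at repaired heights miss `St(Zc)`): under the policy «repair ALL active heights», every member of the transformed boundary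
that meets the new node on its main chart is a translated hyperplane or an inactive translated far quadric. Nothing here is a statement about resolution of
singularities in dimension ≥ 4 / characteristic `p` (NOT proved anywhere in this programme). bears_on: LADDER-RESOLUTION:D157-DOOR2 (res-dim4-pi).
Supports stmt-ResolutionOfSingularities-16155 (helper).
-/

-- every declaration of this summit lives under `Summit.ResolutionOfSingularities.ResolutionOfSingularities`
-- (summit = problem), which the duplicate-namespace linter flags; house convention (cf. the Target file).
set_option linter.dupNamespace false

noncomputable section

open MvPolynomial CategoryTheory AlgebraicGeometry Opposite TopologicalSpace
open AlgebraicGeometry.Scheme.IdealSheafData (ofIdealTop vanishingIdeal)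

namespace Summit.ResolutionOfSingularities.ResolutionOfSingularities.Theorems.PIDim4

open Literature.AlgebraicGeometry.Resolution
open Literature.AlgebraicGeometry.Resolution.Hauser2010
open Literature.AlgebraicGeometry.Resolution.AffinePointBlowup (P A γ coord Wtop ξ)
open Literature.Barriers.ResolutionOfSingularities

namespace ChartDictionary

/-! ## The post-repair reading on the stage, with the second letter -/

section Stage

variable {K : Type} [Field K] {p : ℕ} [hp : Fact p.Prime] [CharP K p]
  {S S' : Finset (Fin 4)} {j : Fin 4} {b : Fin 4 → K} {Θⱼ : A 4 K ≃ₐ[K] A 4 K} {h : MvPolynomial (Fin 4) K}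
  {F F₁ : MvPolynomial (Fin 4) K} {W : Scheme.{0}} {π : W ⟶ P 4 K}

/-- **THE POST-REPAIR READING ON `W`, WITH THE INACTIVE FAR QUADRICS** (pair-list boundary, any finite number of non-zero heights). -/
theorem farRepair_reading_W_pairs_tquadric [IsAlgClosed K] [DecidableEq K] (hj : j ∈ S) (hjS' : j ∉ S') (hbj : b j = 0)
    (h0j : Θⱼ (X 0) = X 0 + rename Fin.succ h) (hsj : ∀ i : Fin 4, Θⱼ (X i.succ) = X i.succ + C (b i))
    (hπ : IsBlowup π (AffineCoordBlowup.𝓘Λ 4 K (insert 0 (Fin.succ '' (S : Set (Fin 4))))))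
    (hperm : (p : ℕ∞) ≤ CentreBlowup.ordAlong S F)
    (hread : Θⱼ (coordBlowupSubst K (insert 0 (Fin.succ '' (S : Set (Fin 4)))) j.succ (hyp p F)) = X j.succ ^ p * hyp p F₁)
    (hperm' : (p : ℕ∞) ≤ CentreBlowup.ordAlong S' F₁) (L : List (Fin 4 × K))
    (hs : List K) (hne : hs ≠ []) (hnd : hs.Nodup) (h0 : ∀ h' ∈ hs, h' ≠ 0) :
    haveI : IsIso (CommRingCat.ofHom (Θⱼ : A 4 K →+* A 4 K)) := (inferInstance : IsIso Θⱼ.toRingEquiv.toCommRingCatIso.hom)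
    let φⱼ := Spec.map (CommRingCat.ofHom (Θⱼ : A 4 K →+* A 4 K)) ≫ AffineCoordBlowup.chartImm hπ (succ_mem_centreVars hj)
    let Zc := vanishingIdeal (closureImage φⱼ ((AffineCoordBlowup.𝓘Λ 4 K (insert 0 (Fin.succ '' (S' : Set (Fin 4))))).support : Set (P 4 K)))
    let M' := ((⟨hypSheaf p F, L.map fun ic => ofIdealTop (Ideal.span {(γ 4 K).symm (X ic.1.succ + C ic.2)}), p⟩ :
        MarkedIdeal (P 4 K)).transform π (AffineCoordBlowup.𝓘Λ 4 K (insert 0 (Fin.succ '' (S : Set (Fin 4))))))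
    let Cmod := (hs.map fun h' => (AffineCoordBlowup.𝓘Λ 4 K (insert 0 (Fin.succ '' ((insert j S' : Finset (Fin 4)) : Set (Fin 4))))).comap
      (Spec.map (CommRingCat.ofHom ((AffinePointBlowup.translateEquiv (n := 4) (Pi.single j.succ (-h')) : A 4 K ≃ₐ[K] A 4 K) :
        A 4 K →+* A 4 K)))).prod
    let CW := vanishingIdeal (closureImage φⱼ (Cmod.support : Set (P 4 K)))
    let out := hs.foldl (fun (acc : K × MvPolynomial (Fin 4) K) (h' : K) =>
      (h', (CentreBlowup.step p (insert j S') j 0 ⟨PointBlowup.translate (Pi.single j (h' - acc.1)) acc.2, 0, ∅⟩).F)) (0, F₁)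
    ∀ ⦃W'' : Scheme.{0}⦄ ⦃τ : W'' ⟶ W⦄, IsBlowup τ CW →
      ∃ (φ : P 4 K ⟶ W'') (_ : IsOpenImmersion φ),
        Set.range (φ ≫ τ) ⊆ Set.range φⱼ ∧
        (strictTransformIdeal τ CW Zc).comap φ = AffineCoordBlowup.𝓘Λ 4 K (insert 0 (Fin.succ '' (S' : Set (Fin 4)))) ∧
        (∀ x : W'', x ∈ ((strictTransformIdeal τ CW Zc).support : Set W'') → τ x ∈ Set.range φⱼ → x ∈ Set.range φ) ∧
        (M'.transform τ CW).ideal.comap φ = hypSheaf p out.2 ∧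
        (p : ℕ∞) ≤ CentreBlowup.ordAlong S' out.2 ∧
        (CW.comap τ).comap φ = (hs.map fun h' => ofIdealTop (Ideal.span {(γ 4 K).symm (X j.succ + C (out.1 - h'))})).prod ∧
        (∀ (D : Scheme.IdealSheafData W) (a : K), D.comap φⱼ = ofIdealTop (Ideal.span {(γ 4 K).symm (X j.succ + C a)}) →
          (strictTransformIdeal τ CW D).comap φ =
            if -a ∈ hs then ⊤ else ofIdealTop (Ideal.span {(γ 4 K).symm (X j.succ + C (a + out.1))})) ∧
        (∀ (D : Scheme.IdealSheafData W), ∀ t ∈ S', D.comap φⱼ = ofIdealTop (Ideal.span {(γ 4 K).symm (X t.succ + C 0)}) →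
          (strictTransformIdeal τ CW D).comap φ = ofIdealTop (Ideal.span {(γ 4 K).symm (X t.succ + C 0)})) ∧
        (∀ (D : Scheme.IdealSheafData W), ∀ i ∉ S', i ≠ j → ∀ a : K, D.comap φⱼ = ofIdealTop (Ideal.span {(γ 4 K).symm (X i.succ + C a)}) →
          (strictTransformIdeal τ CW D).comap φ = ofIdealTop (Ideal.span {(γ 4 K).symm (X i.succ + C a)})) ∧
        (∀ (D : Scheme.IdealSheafData W), ∀ k ∉ S', k ≠ j → ∀ β d : K,
          D.comap φⱼ = ofIdealTop (Ideal.span {(γ 4 K).symm ((X k.succ + C β) * X j.succ - C (0 : K) * X k.succ + C d)}) →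
          (strictTransformIdeal τ CW D).comap φ =
            ofIdealTop (Ideal.span {(γ 4 K).symm ((X k.succ + C β) * X j.succ - C (0 - out.1) * X k.succ + C (d + β * out.1))})) := by
  intro φⱼ Zc M' Cmod CW out W'' τ hτ
  classical
  haveI hisoj : IsIso (CommRingCat.ofHom (Θⱼ : A 4 K →+* A 4 K)) := (inferInstance : IsIso Θⱼ.toRingEquiv.toCommRingCatIso.hom)
  haveI : PerfectRing K p := PerfectRing.ofSurjective K p fun x => IsAlgClosed.exists_pow_nat_eq x hp.out.pos
  haveI : IsOpenImmersion φⱼ := inferInstanceAs (IsOpenImmersion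
    (Spec.map (CommRingCat.ofHom (Θⱼ : A 4 K →+* A 4 K)) ≫ AffineCoordBlowup.chartImm hπ (succ_mem_centreVars hj)))
  haveI : IsProper π := hπ.isProper
  haveI : IsLocallyNoetherian W := LocallyOfFiniteType.isLocallyNoetherian π
  haveI : IsLocallyNoetherian W'' := hτ.isLocallyNoetherian
  -- the repair centre package and the model blowing up over the chart
  obtain ⟨hcomap, -, -, -, -, -⟩ := farRepairCentre_package_pairs hj hjS' hbj h0j hsj hπ hperm hread hperm' L hs hne hnd h0
  have hτV := isBlowup_morphismRestrict_comp_isoOpensRange_inv φⱼ hτ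
  rw [hcomap] at hτV
  obtain ⟨φV, hφV, g1, g2, g3, g4, g5, g6, g7, g8, g9⟩ := farRepair_chart_reading_heights_tquadric hjS' hs hne hnd F₁ hperm' hτV
  have hZc : Zc.comap φⱼ = AffineCoordBlowup.𝓘Λ 4 K (insert 0 (Fin.succ '' (S' : Set (Fin 4)))) := comap_globalCentre _ _
  have hideal : M'.ideal.comap φⱼ = hypSheaf p F₁ := comap_chart_transform_ideal_of_reading hj hbj h0j hsj hπ hperm hread _ rfl rfl
  -- every reading along `φV ≫ ι` is a reading of the model along `φV`
  have hSt : ∀ D : Scheme.IdealSheafData W, (strictTransformIdeal τ CW D).comap (φV ≫ (τ ⁻¹ᵁ φⱼ.opensRange).ι) =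
      (strictTransformIdeal ((τ ∣_ φⱼ.opensRange) ≫ φⱼ.isoOpensRange.inv) Cmod (D.comap φⱼ)).comap φV := by
    intro D
    rw [Scheme.IdealSheafData.comap_comp, ← strictTransformIdeal_model φⱼ, hcomap]
  refine ⟨φV ≫ (τ ⁻¹ᵁ φⱼ.opensRange).ι, inferInstance, ?_, ?_, ?_, ?_, g4, ?_, fun D a hD => ?_, fun D t ht hD => ?_, fun D i hiT hij a hD => ?_,
    fun D k hkT hkj β d hD => ?_⟩
  · -- over the `x_j`-chart
    rintro _ ⟨y, rfl⟩
    have h1 : (τ ⁻¹ᵁ φⱼ.opensRange).ι (φV y) ∈ ((τ ⁻¹ᵁ φⱼ.opensRange : W''.Opens) : Set W'') := by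
      rw [← Scheme.Opens.range_ι]
      exact ⟨_, rfl⟩
    have h2 : τ ((τ ⁻¹ᵁ φⱼ.opensRange).ι (φV y)) ∈ (φⱼ.opensRange : Set W) := h1
    rw [Scheme.Hom.coe_opensRange] at h2
    rw [Scheme.Hom.comp_apply, Scheme.Hom.comp_apply]
    exact h2
  · -- (1)
    rw [hSt, hZc]
    exact g1
  · -- (2)
    intro x hx hxj
    have hxU : x ∈ Set.range (τ ⁻¹ᵁ φⱼ.opensRange).ι := by
      rw [Scheme.Opens.range_ι]
      show τ x ∈ (φⱼ.opensRange : Set W)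
      rw [Scheme.Hom.coe_opensRange]
      exact hxj
    obtain ⟨x', rfl⟩ := hxU
    have hx' := (mem_support_comap_iff _ _ x').mpr hx
    rw [← strictTransformIdeal_model φⱼ, hcomap, hZc] at hx'
    obtain ⟨y, rfl⟩ := g2 hx'
    exact ⟨y, rfl⟩
  · -- (3)
    rw [MarkedIdeal.transform_ideal, Scheme.IdealSheafData.comap_comp, ← controlledTransform_model φⱼ, hcomap, hideal]
    exact g3
  · -- (5)
    rw [Scheme.IdealSheafData.comap_comp, ← comap_centre_model φⱼ, hcomap]
    exact g5
  · -- (6)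
    rw [hSt, hD]
    exact g6 a
  · -- (7)
    rw [hSt, hD]
    exact g7 t ht
  · -- (8)
    rw [hSt, hD]
    exact g8 i hiT hij a
  · -- (9)
    rw [hSt, hD]
    exact g9 k hkT hkj β 0 d (fun hm => h0 0 hm rfl)

end Stage

end ChartDictionary

end Summit.ResolutionOfSingularities.ResolutionOfSingularities.Theorems.PIDim4

end
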